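import Mathlib.MeasureTheory.Integral.IntervalIntegral.FundThmCalculus
import Mathlib.Analysis.SpecialFunctions.Trigonometric.Deriv
import Mathlib.Analysis.SpecialFunctions.ExpDeriv
import Mathlib.MeasureTheory.Constructions.Pi
import Mathlib.MeasureTheory.Integral.Prod
import Mathlib.Algebra.BigOperators.Fin
import HarnessLib

/-!
# The lattice U(1) Schwinger–Dyson identity `⟨R_{l₀,P₀}⟩ = 0` on a finite periodic lattice

HONEST FRAMING: exact (Metropolis-corrected) sampling algorithms for lattice gauge theory;
figures of merit are autocorrelation/cost numbers at stated couplings and volumes; no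
continuum-physics claim.

Venture `LatticeQCDFlow` (cell pub-lqcd), sub-topic `Scoring`; FANOUT row 11 (`eng-scorerA`,
fitness scorer A), GEN-12.  NEW WORK of the cell (placement rule): our own proof of the exact
identity behind the LEADERBOARD-2 docket item L2-A15 (b) — the reference-FREE `V1` test
`⟨R⟩ = 0` (arbiter ARBITRATION-L2-A15.md, RULING 1) — in the abelian case, on the WHOLE finite
lattice.  The companion file `SchwingerDysonOnePlaquette.lean` (GEN-11) did the one-plaquette
instance; its "What is NOT here" named the multi-link statement.  This file supplies it for U(1):
product measure over all links, Fubini, and the one-link integration by parts.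

## Setting (the coordinates every U(1) code of the cell uses)

* `n + 1` links, numbered by `Fin (n + 1)`, with angles `θ : Fin (n + 1) → ℝ`, each integrated over
  ONE Haar period `(0, 2π]` — the measure is Lebesgue on the torus box `(0, 2π]^{n+1}`
  (`u1TorusBox`), i.e. `(2π)^{n+1} ×` product Haar probability on `U(1)^{n+1}`.
* A finite family `Ps` of plaquettes (any index type `ι`), each with INTEGER link incidences
  `inc p : Fin (n + 1) → ℤ`; the plaquette angle is `θ_p = Σ_l inc p l · θ_l` (`u1PlaqAngle`).  A
  hypercubic periodic lattice in any dimension (incidences `±1, 0`), open or defect-weighted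
  variants, and indeed any finite cell complex are instances; nothing below uses more than
  integrality of the incidences.
* Per-plaquette couplings `βp : ι → ℝ` (uniform `β` is `fun _ => β`; defect / open-boundary weights
  are `β_p ∈ [0, β]`): Wilson weight `W(θ) = exp(Σ_{p ∈ Ps} β_p cos θ_p)` (`u1WilsonWeight`).
* The residual of a link `l₀` and a loop `p₀` (ANY integer combination of links — `p₀ ∈ Ps` is not
  needed): `R(θ) = inc p₀ l₀ · cos θ_{p₀} − sin θ_{p₀} · Σ_{p ∈ Ps} β_p · inc p l₀ · sin θ_p`
  (`u1SDResidual`).  For uniform `β`, `inc p₀ l₀ = 1` and a plaquette `p₀ ∋ l₀` this is row 10's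
  `R = cos θ_{P₀} − β Σ_{P ∋ l₀} s_P sin θ_P sin θ_{P₀}` (eng-equiv 0.4.0 `sd`, U(1) branch;
  latflow.core 0.2.4 `schwinger_dyson`, 2-d U(1)).

## Results

* §1 (one-link fibre) `integral_u1FibreResidual_mul_weight`: with all links but `l₀` frozen every
  plaquette angle is affine in `x = θ_{l₀}`, `θ_p = s_p x + c_p` with `s_p ∈ ℤ`;
  `d/dx [sin θ_{p₀}(x) · E(x)] = R(x) E(x)` and `sin θ_{p₀} · E` takes the same value at `x = 0`
  and `x = 2π` (integer `s_p`), so `∫_0^{2π} R E dx = 0`.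
* §2 (lattice) **`setIntegral_u1SDResidual_mul_wilsonWeight`**:
  `∫_{(0,2π]^{n+1}} R(θ) W(θ) dθ = 0` — Fubini (`MeasureTheory.measurePreserving_piFinSuccAbove`)
  splits off the `l₀` coordinate, the inner integral is §1 at the offsets of the frozen links.
* **`u1WilsonExpect_sdResidual_eq_zero`**: `⟨R_{l₀,p₀}⟩ = 0` under the normalised Wilson law
  (`u1WilsonZ_pos`), and the Makeenko–Migdal form **`u1WilsonExpect_loop_cos_eq`**:
  `inc p₀ l₀ · ⟨cos θ_{p₀}⟩ = ⟨sin θ_{p₀} Σ_p β_p inc p l₀ sin θ_p⟩`.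

What is NOT here: the non-abelian statement (left-invariance of Haar on `SU(N)`), and the same
identity phrased for the abstract compact-group Wilson measure of
`Literature.MathematicalPhysics.QuantumFieldTheory.ConstructiveQFTWave0` (`GaugeConfig`,
`wilsonWeight` via `haarMeasure`); no claim about the statistical power of the scorer's test.
-/

namespace Summit.Ventures.LatticeQCDFlow.Scoring

open Real MeasureTheory intervalIntegral Set Finset

/-! ### §1 The one-link fibre -/

section Fibre

variable {ι : Type*} (Ps : Finset ι) (s : ι → ℤ) (βp : ι → ℝ) (c : ι → ℝ)

/-- Along the fibre of ONE link angle `x` (all other links frozen) every plaquette angle is affine: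
`θ_p(x) = s_p · x + c_p`, integer incidence `s_p`, offset `c_p` from the frozen links. -/
def u1FibreAngle (p : ι) (x : ℝ) : ℝ := (s p : ℝ) * x + c p

/-- The Wilson weight along the fibre: `E(x) = exp(Σ_{p ∈ Ps} β_p cos θ_p(x))`. -/
noncomputable def u1FibreWeight (x : ℝ) : ℝ :=
  Real.exp (∑ p ∈ Ps, βp p * Real.cos (u1FibreAngle s c p x))

/-- The Schwinger–Dyson residual of the link and the loop `p₀` along the fibre:
`R(x) = s_{p₀} cos θ_{p₀}(x) − sin θ_{p₀}(x) · Σ_{p ∈ Ps} β_p s_p sin θ_p(x)`. -/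
noncomputable def u1FibreResidual (p₀ : ι) (x : ℝ) : ℝ :=
  (s p₀ : ℝ) * Real.cos (u1FibreAngle s c p₀ x)
    - Real.sin (u1FibreAngle s c p₀ x) * ∑ p ∈ Ps, βp p * (s p : ℝ) * Real.sin (u1FibreAngle s c p x)

/-- `d/dx θ_p(x) = s_p`. -/
theorem hasDerivAt_u1FibreAngle (p : ι) (x : ℝ) :
    HasDerivAt (u1FibreAngle s c p) (s p : ℝ) x := by
  show HasDerivAt (fun y => (s p : ℝ) * y + c p) (s p : ℝ) x
  simpa using ((hasDerivAt_id x).const_mul (s p : ℝ)).add_const (c p)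

/-- `d/dx E(x) = E(x) · Σ_p β_p (−sin θ_p(x) · s_p)`. -/
theorem hasDerivAt_u1FibreWeight (x : ℝ) :
    HasDerivAt (u1FibreWeight Ps s βp c)
      (u1FibreWeight Ps s βp c x
        * ∑ p ∈ Ps, βp p * (-Real.sin (u1FibreAngle s c p x) * (s p : ℝ))) x := by
  have hsum : HasDerivAt (fun y => ∑ p ∈ Ps, βp p * Real.cos (u1FibreAngle s c p y))
      (∑ p ∈ Ps, βp p * (-Real.sin (u1FibreAngle s c p x) * (s p : ℝ))) x :=
    HasDerivAt.fun_sum fun p _ => ((hasDerivAt_u1FibreAngle s c p x).cos).const_mul (βp p)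
  show HasDerivAt (fun y => Real.exp (∑ p ∈ Ps, βp p * Real.cos (u1FibreAngle s c p y)))
    (Real.exp (∑ p ∈ Ps, βp p * Real.cos (u1FibreAngle s c p x))
      * ∑ p ∈ Ps, βp p * (-Real.sin (u1FibreAngle s c p x) * (s p : ℝ))) x
  exact hsum.exp

/-- **The integration-by-parts identity behind the test:** `d/dx [sin θ_{p₀}(x) · E(x)] = R(x) · E(x)`. -/
theorem hasDerivAt_sin_u1FibreAngle_mul_weight (p₀ : ι) (x : ℝ) :
    HasDerivAt (fun y => Real.sin (u1FibreAngle s c p₀ y) * u1FibreWeight Ps s βp c y)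
      (u1FibreResidual Ps s βp c p₀ x * u1FibreWeight Ps s βp c x) x := by
  have h1 : HasDerivAt (fun y => Real.sin (u1FibreAngle s c p₀ y))
      (Real.cos (u1FibreAngle s c p₀ x) * (s p₀ : ℝ)) x := (hasDerivAt_u1FibreAngle s c p₀ x).sin
  have h := h1.mul (hasDerivAt_u1FibreWeight Ps s βp c x)
  have hs : ∑ p ∈ Ps, βp p * (-Real.sin (u1FibreAngle s c p x) * (s p : ℝ))
      = -∑ p ∈ Ps, βp p * (s p : ℝ) * Real.sin (u1FibreAngle s c p x) := by
    rw [← Finset.sum_neg_distrib]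
    exact Finset.sum_congr rfl fun p _ => by ring
  rw [hs] at h
  exact h.congr_deriv (by unfold u1FibreResidual; ring)

/-- Going once around the link: `θ_p(2π) = θ_p(0) + s_p · 2π`. -/
theorem u1FibreAngle_two_pi (p : ι) :
    u1FibreAngle s c p (2 * π) = u1FibreAngle s c p 0 + (s p : ℝ) * (2 * π) := by
  unfold u1FibreAngle
  ring

/-- `cos θ_p(2π) = cos θ_p(0)` (integer incidence). -/
theorem cos_u1FibreAngle_two_pi (p : ι) :
    Real.cos (u1FibreAngle s c p (2 * π)) = Real.cos (u1FibreAngle s c p 0) := by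
  rw [u1FibreAngle_two_pi, Real.cos_add_int_mul_two_pi]

/-- `sin θ_p(2π) = sin θ_p(0)` (integer incidence). -/
theorem sin_u1FibreAngle_two_pi (p : ι) :
    Real.sin (u1FibreAngle s c p (2 * π)) = Real.sin (u1FibreAngle s c p 0) := by
  rw [u1FibreAngle_two_pi, Real.sin_add_int_mul_two_pi]

/-- `E(2π) = E(0)`. -/
theorem u1FibreWeight_two_pi : u1FibreWeight Ps s βp c (2 * π) = u1FibreWeight Ps s βp c 0 := by
  unfold u1FibreWeight
  simp_rw [cos_u1FibreAngle_two_pi]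

/-- `x ↦ R(x) E(x)` is continuous. -/
theorem continuous_u1FibreResidual_mul_weight (p₀ : ι) :
    Continuous fun x => u1FibreResidual Ps s βp c p₀ x * u1FibreWeight Ps s βp c x := by
  unfold u1FibreResidual u1FibreWeight u1FibreAngle
  fun_prop

/-- **One-link Schwinger–Dyson identity (unnormalised):** for every family of integer incidences,
couplings and offsets, `∫_0^{2π} R(x) E(x) dx = 0`. -/
theorem integral_u1FibreResidual_mul_weight (p₀ : ι) :
    ∫ x in (0 : ℝ)..(2 * π), u1FibreResidual Ps s βp c p₀ x * u1FibreWeight Ps s βp c x = 0 := by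
  rw [integral_eq_sub_of_hasDerivAt
    (f := fun y => Real.sin (u1FibreAngle s c p₀ y) * u1FibreWeight Ps s βp c y)
    (fun x _ => hasDerivAt_sin_u1FibreAngle_mul_weight Ps s βp c p₀ x)
    ((continuous_u1FibreResidual_mul_weight Ps s βp c p₀).intervalIntegrable _ _)]
  show Real.sin (u1FibreAngle s c p₀ (2 * π)) * u1FibreWeight Ps s βp c (2 * π)
      - Real.sin (u1FibreAngle s c p₀ 0) * u1FibreWeight Ps s βp c 0 = 0
  rw [sin_u1FibreAngle_two_pi, u1FibreWeight_two_pi, sub_self]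

end Fibre

/-! ### §2 The finite lattice: product measure over all links and Fubini -/

section Lattice

variable {n : ℕ} {ι : Type*} (Ps : Finset ι) (inc : ι → Fin (n + 1) → ℤ) (βp : ι → ℝ)

/-- The angle of the plaquette (or loop) `p`: the integer combination `θ_p = Σ_l inc p l · θ_l` of the
link angles. -/
def u1PlaqAngle (p : ι) (θ : Fin (n + 1) → ℝ) : ℝ := ∑ l, (inc p l : ℝ) * θ l

/-- The U(1) Wilson weight with per-plaquette couplings: `W(θ) = exp(Σ_{p ∈ Ps} β_p cos θ_p)`. -/
noncomputable def u1WilsonWeight (θ : Fin (n + 1) → ℝ) : ℝ :=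
  Real.exp (∑ p ∈ Ps, βp p * Real.cos (u1PlaqAngle inc p θ))

/-- The lattice Schwinger–Dyson residual of link `l₀` and loop `p₀`:
`R(θ) = inc p₀ l₀ · cos θ_{p₀} − sin θ_{p₀} · Σ_{p ∈ Ps} β_p · inc p l₀ · sin θ_p`. -/
noncomputable def u1SDResidual (l₀ : Fin (n + 1)) (p₀ : ι) (θ : Fin (n + 1) → ℝ) : ℝ :=
  (inc p₀ l₀ : ℝ) * Real.cos (u1PlaqAngle inc p₀ θ)
    - Real.sin (u1PlaqAngle inc p₀ θ)
      * ∑ p ∈ Ps, βp p * (inc p l₀ : ℝ) * Real.sin (u1PlaqAngle inc p θ)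

/-- The offset of plaquette `p` from the frozen links (all but `l₀`, in `Fin.succAbove` numbering). -/
def u1FrozenOffset (l₀ : Fin (n + 1)) (p : ι) (rest : Fin n → ℝ) : ℝ :=
  ∑ j, (inc p (l₀.succAbove j) : ℝ) * rest j

/-- Along the `l₀`-fibre the plaquette angle is the affine fibre angle with slope `inc p l₀` and the
frozen offset: `θ_p(θ[l₀ := x]) = inc p l₀ · x + Σ_{l ≠ l₀} inc p l · θ_l`. -/
theorem u1PlaqAngle_insertNth (l₀ : Fin (n + 1)) (p : ι) (x : ℝ) (rest : Fin n → ℝ) :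
    u1PlaqAngle inc p (l₀.insertNth x rest)
      = u1FibreAngle (fun q => inc q l₀) (fun q => u1FrozenOffset inc l₀ q rest) p x := by
  unfold u1PlaqAngle u1FibreAngle u1FrozenOffset
  rw [Fin.sum_univ_succAbove _ l₀]
  simp only [Fin.insertNth_apply_same, Fin.insertNth_apply_succAbove]

/-- The Wilson weight along the fibre is the fibre weight. -/
theorem u1WilsonWeight_insertNth (l₀ : Fin (n + 1)) (x : ℝ) (rest : Fin n → ℝ) :
    u1WilsonWeight Ps inc βp (l₀.insertNth x rest)
      = u1FibreWeight Ps (fun q => inc q l₀) βp (fun q => u1FrozenOffset inc l₀ q rest) x := by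
  unfold u1WilsonWeight u1FibreWeight
  simp_rw [u1PlaqAngle_insertNth]

/-- The residual along the fibre is the fibre residual. -/
theorem u1SDResidual_insertNth (l₀ : Fin (n + 1)) (p₀ : ι) (x : ℝ) (rest : Fin n → ℝ) :
    u1SDResidual Ps inc βp l₀ p₀ (l₀.insertNth x rest)
      = u1FibreResidual Ps (fun q => inc q l₀) βp (fun q => u1FrozenOffset inc l₀ q rest) p₀ x := by
  unfold u1SDResidual u1FibreResidual
  simp_rw [u1PlaqAngle_insertNth]

/-- **Inner integral:** for every configuration of the other links,
`∫_0^{2π} R(θ[l₀ := x]) W(θ[l₀ := x]) dx = 0`. -/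
theorem integral_fibre_u1SDResidual_mul_wilsonWeight (l₀ : Fin (n + 1)) (p₀ : ι)
    (rest : Fin n → ℝ) :
    ∫ x in (0 : ℝ)..(2 * π), u1SDResidual Ps inc βp l₀ p₀ (l₀.insertNth x rest)
        * u1WilsonWeight Ps inc βp (l₀.insertNth x rest) = 0 := by
  simp_rw [u1SDResidual_insertNth, u1WilsonWeight_insertNth]
  exact integral_u1FibreResidual_mul_weight _ _ _ _ _

/-- The torus box `(0, 2π]^m`: one Haar period per link. -/
def u1TorusBox (m : ℕ) : Set (Fin m → ℝ) := Set.univ.pi fun _ => Set.Ioc 0 (2 * π)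

/-- Lebesgue measure restricted to the torus box is the product of the one-link measures
`dθ|_{(0,2π]}` (so it is `(2π)^m ×` product Haar probability on `U(1)^m`). -/
theorem volume_restrict_u1TorusBox (m : ℕ) :
    (volume : Measure (Fin m → ℝ)).restrict (u1TorusBox m)
      = Measure.pi fun _ : Fin m => (volume : Measure ℝ).restrict (Set.Ioc 0 (2 * π)) := by
  rw [u1TorusBox, volume_pi, Measure.restrict_pi_pi]

/-- A continuous function is integrable on the torus box. -/
theorem integrableOn_u1TorusBox {m : ℕ} {f : (Fin m → ℝ) → ℝ} (hf : Continuous f) :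
    IntegrableOn f (u1TorusBox m) volume :=
  (hf.continuousOn.integrableOn_compact (isCompact_univ_pi fun _ => isCompact_Icc)).mono_set
    (Set.pi_mono fun _ _ => Set.Ioc_subset_Icc_self)

/-- The plaquette angle is continuous in the configuration. -/
theorem continuous_u1PlaqAngle (p : ι) : Continuous (u1PlaqAngle inc p) := by
  unfold u1PlaqAngle
  fun_prop

/-- The Wilson weight is continuous. -/
theorem continuous_u1WilsonWeight : Continuous (u1WilsonWeight Ps inc βp) := by
  unfold u1WilsonWeight
  have h := fun p => continuous_u1PlaqAngle inc p
  fun_prop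

/-- The residual is continuous. -/
theorem continuous_u1SDResidual (l₀ : Fin (n + 1)) (p₀ : ι) :
    Continuous (u1SDResidual Ps inc βp l₀ p₀) := by
  unfold u1SDResidual
  have h := fun p => continuous_u1PlaqAngle inc p
  fun_prop

/-- **The lattice U(1) Schwinger–Dyson identity (unnormalised).**  For every finite lattice
(`n + 1` links, plaquettes `Ps` with integer incidences, per-plaquette couplings), every link `l₀`
and every integer loop `p₀`: `∫_{(0,2π]^{n+1}} R_{l₀,p₀}(θ) · exp(Σ_p β_p cos θ_p) dθ = 0`. -/
theorem setIntegral_u1SDResidual_mul_wilsonWeight (l₀ : Fin (n + 1)) (p₀ : ι) :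
    ∫ θ in u1TorusBox (n + 1), u1SDResidual Ps inc βp l₀ p₀ θ * u1WilsonWeight Ps inc βp θ = 0 := by
  set F : (Fin (n + 1) → ℝ) → ℝ :=
    fun θ => u1SDResidual Ps inc βp l₀ p₀ θ * u1WilsonWeight Ps inc βp θ with hF_def
  have hF : Continuous F :=
    (continuous_u1SDResidual Ps inc βp l₀ p₀).mul (continuous_u1WilsonWeight Ps inc βp)
  set e := MeasurableEquiv.piFinSuccAbove (fun _ : Fin (n + 1) => ℝ) l₀ with he_def
  have he : MeasurePreserving e ((volume : Measure (Fin (n + 1) → ℝ)).restrict (u1TorusBox (n + 1)))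
      (((volume : Measure ℝ).restrict (Set.Ioc 0 (2 * π))).prod
        ((volume : Measure (Fin n → ℝ)).restrict (u1TorusBox n))) := by
    rw [volume_restrict_u1TorusBox, volume_restrict_u1TorusBox]
    exact measurePreserving_piFinSuccAbove
      (fun _ : Fin (n + 1) => (volume : Measure ℝ).restrict (Set.Ioc 0 (2 * π))) l₀
  have hes : ∀ (x : ℝ) (rest : Fin n → ℝ), e.symm (x, rest) = l₀.insertNth x rest :=
    fun _ _ => rfl
  have hint : Integrable (fun q : ℝ × (Fin n → ℝ) => F (e.symm q))
      (((volume : Measure ℝ).restrict (Set.Ioc 0 (2 * π))).prod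
        ((volume : Measure (Fin n → ℝ)).restrict (u1TorusBox n))) :=
    ((he.symm e).integrable_comp_emb e.symm.measurableEmbedding).mpr (integrableOn_u1TorusBox hF)
  calc ∫ θ in u1TorusBox (n + 1), F θ
      = ∫ q, F (e.symm q) ∂(((volume : Measure ℝ).restrict (Set.Ioc 0 (2 * π))).prod
          ((volume : Measure (Fin n → ℝ)).restrict (u1TorusBox n))) :=
        ((he.symm e).integral_comp' F).symm
    _ = ∫ rest in u1TorusBox n, ∫ x in Set.Ioc 0 (2 * π), F (e.symm (x, rest)) :=
        integral_prod_symm _ hint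
    _ = ∫ rest in u1TorusBox n, (0 : ℝ) := by
        refine integral_congr_ae (Filter.Eventually.of_forall fun rest => ?_)
        simp only [hes, hF_def]
        rw [← intervalIntegral.integral_of_le (by positivity : (0 : ℝ) ≤ 2 * π)]
        exact integral_fibre_u1SDResidual_mul_wilsonWeight Ps inc βp l₀ p₀ rest
    _ = 0 := by simp

/-- The Wilson partition function on the torus box, `Z = ∫_{(0,2π]^{n+1}} W(θ) dθ`. -/
noncomputable def u1WilsonZ : ℝ := ∫ θ in u1TorusBox (n + 1), u1WilsonWeight Ps inc βp θ

/-- The torus box has positive volume `(2π)^m`. -/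
theorem volume_u1TorusBox_pos (m : ℕ) : 0 < (volume : Measure (Fin m → ℝ)) (u1TorusBox m) := by
  rw [u1TorusBox, volume_pi_pi]
  refine pos_iff_ne_zero.mpr (Finset.prod_ne_zero_iff.mpr fun i _ => ?_)
  rw [Real.volume_Ioc]
  exact (ENNReal.ofReal_pos.mpr (by linarith [Real.pi_pos])).ne'

/-- `Z > 0`. -/
theorem u1WilsonZ_pos : 0 < u1WilsonZ Ps inc βp := by
  unfold u1WilsonZ
  have hnn : 0 ≤ᵐ[(volume : Measure (Fin (n + 1) → ℝ)).restrict (u1TorusBox (n + 1))]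
      u1WilsonWeight Ps inc βp :=
    Filter.Eventually.of_forall fun θ => (Real.exp_pos _).le
  rw [setIntegral_pos_iff_support_of_nonneg_ae hnn
    (integrableOn_u1TorusBox (continuous_u1WilsonWeight Ps inc βp))]
  have hsupp : Function.support (u1WilsonWeight Ps inc βp) = Set.univ :=
    Set.eq_univ_of_forall fun θ => Function.mem_support.mpr (Real.exp_pos _).ne'
  rw [hsupp, Set.univ_inter]
  exact volume_u1TorusBox_pos (n + 1)

/-- The Wilson expectation `⟨f⟩ = (1/Z) ∫_{(0,2π]^{n+1}} f(θ) W(θ) dθ`. -/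
noncomputable def u1WilsonExpect (f : (Fin (n + 1) → ℝ) → ℝ) : ℝ :=
  (∫ θ in u1TorusBox (n + 1), f θ * u1WilsonWeight Ps inc βp θ) / u1WilsonZ Ps inc βp

/-- **`⟨R_{l₀,p₀}⟩ = 0` under the finite-lattice U(1) Wilson law** — the exact value the scorer's
key-free identity test compares a chain's `sd_re` mean against (2-d U(1): row 14 fthmc, row 4 flows;
any dimension, any integer loop `p₀`, any per-plaquette couplings). -/
theorem u1WilsonExpect_sdResidual_eq_zero (l₀ : Fin (n + 1)) (p₀ : ι) :
    u1WilsonExpect Ps inc βp (u1SDResidual Ps inc βp l₀ p₀) = 0 := by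
  unfold u1WilsonExpect
  rw [setIntegral_u1SDResidual_mul_wilsonWeight, zero_div]

/-- **Makeenko–Migdal form:** `inc p₀ l₀ · ⟨cos θ_{p₀}⟩ = ⟨sin θ_{p₀} · Σ_p β_p inc p l₀ sin θ_p⟩` —
the loop expectation equals the coupling-weighted "staple" correlator through the link. -/
theorem u1WilsonExpect_loop_cos_eq (l₀ : Fin (n + 1)) (p₀ : ι) :
    (inc p₀ l₀ : ℝ) * u1WilsonExpect Ps inc βp (fun θ => Real.cos (u1PlaqAngle inc p₀ θ))
      = u1WilsonExpect Ps inc βp (fun θ => Real.sin (u1PlaqAngle inc p₀ θ)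
          * ∑ p ∈ Ps, βp p * (inc p l₀ : ℝ) * Real.sin (u1PlaqAngle inc p θ)) := by
  have hP := fun p => continuous_u1PlaqAngle inc p
  have hW := continuous_u1WilsonWeight Ps inc βp
  have hA : Continuous fun θ => Real.cos (u1PlaqAngle inc p₀ θ) * u1WilsonWeight Ps inc βp θ := by
    fun_prop
  have hB : Continuous fun θ => (Real.sin (u1PlaqAngle inc p₀ θ)
      * ∑ p ∈ Ps, βp p * (inc p l₀ : ℝ) * Real.sin (u1PlaqAngle inc p θ))
        * u1WilsonWeight Ps inc βp θ := by
    fun_prop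
  have hIA := integrableOn_u1TorusBox (m := n + 1) hA
  have hIB := integrableOn_u1TorusBox (m := n + 1) hB
  have h0 := setIntegral_u1SDResidual_mul_wilsonWeight Ps inc βp l₀ p₀
  have hsplit : (fun θ => u1SDResidual Ps inc βp l₀ p₀ θ * u1WilsonWeight Ps inc βp θ)
      = fun θ => (inc p₀ l₀ : ℝ) * (Real.cos (u1PlaqAngle inc p₀ θ) * u1WilsonWeight Ps inc βp θ)
          - (Real.sin (u1PlaqAngle inc p₀ θ)
              * ∑ p ∈ Ps, βp p * (inc p l₀ : ℝ) * Real.sin (u1PlaqAngle inc p θ))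
            * u1WilsonWeight Ps inc βp θ := by
    funext θ; unfold u1SDResidual; ring
  rw [hsplit, MeasureTheory.integral_sub (hIA.const_mul _) hIB, MeasureTheory.integral_const_mul,
    sub_eq_zero] at h0
  simp only [u1WilsonExpect]
  rw [← mul_div_assoc, h0]

end Lattice

end Summit.Ventures.LatticeQCDFlow.Scoring
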